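import Literature.IUT.HodgeArakelov.ThetaEnvDataRecordModel
import HarnessLib

/-!
# [IUTchII] Prop 3.1 (i)(ii) at the model — the PRINT-FAITHFUL inversion family (outer `ι_Ÿ`)

Companion (abc-iut cell, W6-S6 row (γ) continued; seat abc-iut-w4-d019) of `ThetaEnvDataRecordModel.lean` (p419125) —
its v2 READING CORRECTION made constructive. S. Mochizuki, *Inter-universal Teichmüller theory II*, kurims manuscript
(Dec. 2020), Rmk. 1.4.1 (ii) p. 28: "the unique order two automorphism `ι_X̲` of `X̲̲_k` over `k` … corresponds at the
level of tempered fundamental groups … to the unique order two `Δ^tp_{X̲̲_k}`-OUTER automorphism of `Π^tp_{X̲̲_k}` over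
`G_k`"; `ι_Ÿ` "is uniquely determined up to `l·ℤ`-conjugacy and composition with an element `∈ Gal(Ÿ̲̲_k/Y̲̲_k)`";
Prop. 3.1 (i) p. 87: "`ι` ranges over the inversion automorphisms of Proposition 2.2, (i)" [cite: Mochizuki2012,
Prop 3.1 (i) p.87]. Claim key `Mochizuki2012` (D-0012, DISPUTED); nothing of the series is asserted; no side is taken
on [IUTchIII] Cor. 3.12. ONE def (`EtaleLevels.thetaEnvRecordOuter`, an instance of the landed bridge
`ThetaEnvData.toRecord`) + one `abbrev`; no `Prop` defs.

CONTENT. The inversions are modelled as the `Π^tp_{X̲̲}`-conjugates `conj_g ∘ e₀ ∘ conj_g⁻¹` of the action `e₀` of ONE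
pointed inversion on `lim_J H¹(Π^tp_{Ÿ̲̲} ∩ J, l·Δ_Θ)` — `e₀` an arbitrary additive automorphism (a DATUM: e.g. the
transport `h1LimAutEquiv` of the automorphism pair `(ι_Ÿ, ι^Θ)`, abc-iut-L6-t1 `CohomologyAutEquiv` / abc-iut-w4-d010 /
w5-d072) — instead of the v1 family of INNER conjugates of an element (which only covers the `(l·ℤ) × μ_2`-translates).
Since the conjugate-inversion law holds for this family by pure group theory (`h1LimConjEquiv_conjugate_outer`, in
`ThetaEnvDataRecordModel` v2), **J2 (`ThetaEnvPermuted`) holds at the genuine data with NO hypothesis on `e₀`**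
(`thetaEnvPermuted_thetaEnvRecordOuter`, via abc-iut-w4-d030's `thetaEnvPermuted_record`); with `κ :=` abc-iut-w4-d007's
`h1LimKummerOn c hA hfi O`: `Ψ_cns` conjugation-stable, `Prop31Statements.conj_permutes` for both families, and
[IUTchII] Prop. 3.1 (ii) both clauses under the one input `hinj` (`prop31ii_thetaEnvRecordOuterKummer`).
-/

noncomputable section

namespace Literature.IUT.HodgeArakelov

open Literature.AnabelianGeometry.EtaleTheta CohomologySystemOfContH1

namespace EtaleLevels

open EtaleThetaDataOfSetting

variable {p : ℕ} [Fact p.Prime] {D : Literature.AnabelianGeometry.EtaleTheta.ThetaSetting p}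
  {E : D.EtaleThetaData} {l : ℕ} (C : E.DoubleUnderline l) (hC : D.Compat) (hS : D.Sec2Hyps)
  (hl : l.Prime) (hp2 : p ≠ 2) (hpl : p ≠ l) (hζ : ∃ ζ : D.K, IsPrimitiveRoot ζ (4 * l))
  (mods : ∀ M : ℕ+, D.CyclotomeMod l M)
  (f : contCocycles D.toTheta D.DeltaTheta C.GtpYdduu) (hf : f ∈ C.rootCocycles hC)
  (hmods : ∀ (M M' : ℕ+) (h : (M : ℕ) ∣ (M' : ℕ)) (x : D.lDeltaTheta l),
    MuN.red p M M' h ((mods M').red x) = (mods M).red x)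
  (h15 : Literature.AnabelianGeometry.EtaleTheta.ThetaSetting.Prop15iii E hC) (L : C.CuspLabels)
  (hZ : ∀ M : ℕ+, Nonempty (ModelCyclotomes.lDeltaQuot (C.rigidData (mods M) hC hS h15 L) ≃*
    Literature.IUT.HodgeTheaters.ZHat))
  (hcharY : EtaleThetaDataOfSetting.PiYddCharacteristic C)
  (hlim : Function.Bijective (rigidLimHom C hC hS hl hp2 hpl hζ mods f hf hmods h15 L hZ))
  [(EtaleThetaDataOfSetting.PiYdd C).Normal]


section Outer

variable {M : Type} [CommMonoid M]
  (κ : M →* Multiplicative (h1Lim (phi C) (D.lDeltaTheta l) (PiYdd C) ⊥))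
  (e₀ : h1Lim (phi C) (D.lDeltaTheta l) (PiYdd C) ⊥ ≃+ h1Lim (phi C) (D.lDeltaTheta l) (PiYdd C) ⊥)

/-- **The Prop. 3.1 input record of the natural system, PRINT-FAITHFUL inversion family** ([IUTchII] Prop. 3.1 (i)
p. 87 "`ι` ranges over the inversion automorphisms of Proposition 2.2, (i)"; Rmk. 1.4.1 (ii) p. 28: `ι_Ÿ` OUTER, unique up to
`l·ℤ`-conjugacy and `Gal(Ÿ̲̲/Y̲̲)`): as `thetaEnvRecord`, but the inversions are the `Π^tp_{X̲̲}`-conjugates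
`conj_g ∘ e₀ ∘ conj_g⁻¹` of the action `e₀` of ONE pointed inversion on `lim_J H¹(Π^tp_{Ÿ̲̲} ∩ J, l·Δ_Θ)` (a datum: e.g. the
transport `h1LimAutEquiv` of the automorphism pair `(ι_Ÿ, ι^Θ)`, abc-iut-L6-t1 `CohomologyAutEquiv` / w4-d010 / w5-d072).
[claim: Mochizuki2012, status: disputed] (IUTchII §3 Prop 3.1 (i), kurims p.87) -/
def thetaEnvRecordOuter :
    TemperedThetaMonoids.ThetaEnvData.{0, 0} (modelSystem C hC hS hl hp2 hpl hζ mods f hf hmods h15 L hZ).PiX :=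
  (thetaEnvData C hC hS hl hp2 hpl hζ mods f hf hmods h15 L hZ hcharY hlim).toRecord
    (h1LimConjMulAut (phi C) (D.lDeltaTheta l) (PiYdd C)) κ
    (fun g : Pi C => ((h1LimConjEquiv (phi C) (D.lDeltaTheta l) (PiYdd C) g).symm.trans e₀).trans
      (h1LimConjEquiv (phi C) (D.lDeltaTheta l) (PiYdd C) g))

include hcharY in
/-- **J2 AT THE MODEL for the print-faithful family, NO hypothesis on the inversion action `e₀`**: the conjugation action
of `Π^tp_{X̲̲}` permutes `{θ^ι_env}_ι`, `{∞θ^ι_env}_ι` (abc-iut-w5-d169's `ThetaEnvPermuted`) for `thetaEnvRecordOuter κ e₀` —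
abc-iut-w4-d030's `thetaEnvPermuted_record` with its residual `hι` discharged by `h1LimConjEquiv_conjugate_outer`.
[claim: Mochizuki2012, status: disputed] (IUTchII §3 Prop 3.1 (i), kurims p.87) -/
theorem thetaEnvPermuted_thetaEnvRecordOuter :
    (thetaEnvRecordOuter C hC hS hl hp2 hpl hζ mods f hf hmods h15 L hZ hcharY hlim κ e₀).ThetaEnvPermuted := by
  refine thetaEnvPermuted_record C hC hS hl hp2 hpl hζ mods f hf hmods h15 L hZ hcharY hlim κ _ fun g i => ?_
  exact ⟨g * i, fun x => h1LimConjEquiv_conjugate_outer (phi C) (D.lDeltaTheta l) (PiYdd C) e₀ g i x⟩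

variable {A : Type} [CommGroup A] [MulDistribMulAction (Pi C) A] [TopologicalSpace A] [RootableBy A ℕ]
  (c : CyclotomeCoefficients (phi C) (D.lDeltaTheta l) A)
  (hA : ∀ b : A, IsOpen (MulAction.stabilizer (Pi C) b : Set (Pi C)))
  (hfi : ∀ b : A, (MulAction.stabilizer (Pi C) b).FiniteIndex)
  (O : Submonoid A) (hO : ∀ (σ : Pi C) (b : A), b ∈ O → σ • b ∈ O)

/-- `thetaEnvRecordOuter` with `κ :=` abc-iut-w4-d007's Kummer map `h1LimKummerOn c hA hfi O` of a `Π^tp_{X̲̲}`-stable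
constant monoid `O` ("`Ψ_cns(M^Θ_*) := M_TM(M^Θ_*)`"). [claim: Mochizuki2012, status: disputed] (IUTchII §3 Prop 3.1 (ii), kurims p.88) -/
abbrev thetaEnvRecordOuterKummer :
    TemperedThetaMonoids.ThetaEnvData.{0, 0} (modelSystem C hC hS hl hp2 hpl hζ mods f hf hmods h15 L hZ).PiX :=
  thetaEnvRecordOuter C hC hS hl hp2 hpl hζ mods f hf hmods h15 L hZ hcharY hlim
    (h1LimKummerOn (phi C) (D.lDeltaTheta l) (PiYdd C) c hA hfi O) e₀

include hcharY hO in
/-- `Ψ_cns` of `thetaEnvRecordOuterKummer` is conjugation-stable (the field `Prop31Statements.constants_stable`; the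
constant-monoid clause does not involve the inversion family). [claim: Mochizuki2012, status: disputed] (IUTchII §3 Prop 3.1 (ii), kurims p.88) -/
theorem constantMonoid_stable_thetaEnvRecordOuter :
    (thetaEnvRecordOuterKummer C hC hS hl hp2 hpl hζ mods f hf hmods h15 L hZ hcharY hlim e₀ c hA hfi O).IsConjStable
      (thetaEnvRecordOuterKummer C hC hS hl hp2 hpl hζ mods f hf hmods h15 L hZ hcharY hlim e₀ c hA hfi O).constantMonoid := by
  intro g' x hx
  let g : Pi C := g'
  change x ∈ MonoidHom.mrange _ at hx
  obtain ⟨m, rfl⟩ := hx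
  change h1LimConjMulAut (phi C) (D.lDeltaTheta l) (PiYdd C) g
      (h1LimKummerOn (phi C) (D.lDeltaTheta l) (PiYdd C) c hA hfi O m) ∈ MonoidHom.mrange _
  exact ⟨⟨g • (m : A), hO g m m.2⟩,
    h1LimKummerOn_smul (phi C) (D.lDeltaTheta l) (PiYdd C) c hA hfi O g m ⟨g • (m : A), hO g m m.2⟩ rfl⟩

include hcharY hO in
/-- **`Prop31Statements.conj_permutes` AT THE MODEL for the print-faithful family, BOTH families of theta monoids**
(via abc-iut-w4-d030's `conj_permutes_both_record`, `M^×_TM` stable by `toRecord_units_stable`).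
[claim: Mochizuki2012, status: disputed] (IUTchII §3 Prop 3.1 (i), kurims p.87) -/
theorem conj_permutes_thetaEnvRecordOuter :
    ∀ (g : Pi C) (ι : Pi C), ∃ ι' : Pi C,
      ((thetaEnvRecordOuterKummer C hC hS hl hp2 hpl hζ mods f hf hmods h15 L hZ hcharY hlim e₀ c hA hfi O).thetaMonoid ι).map
        ((thetaEnvRecordOuterKummer C hC hS hl hp2 hpl hζ mods f hf hmods h15 L hZ hcharY hlim e₀ c hA hfi O).conj g).toMonoidHom =
        (thetaEnvRecordOuterKummer C hC hS hl hp2 hpl hζ mods f hf hmods h15 L hZ hcharY hlim e₀ c hA hfi O).thetaMonoid ι' ∧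
      ((thetaEnvRecordOuterKummer C hC hS hl hp2 hpl hζ mods f hf hmods h15 L hZ hcharY hlim e₀ c hA hfi O).inftyThetaMonoid ι).map
        ((thetaEnvRecordOuterKummer C hC hS hl hp2 hpl hζ mods f hf hmods h15 L hZ hcharY hlim e₀ c hA hfi O).conj g).toMonoidHom =
        (thetaEnvRecordOuterKummer C hC hS hl hp2 hpl hζ mods f hf hmods h15 L hZ hcharY hlim e₀ c hA hfi O).inftyThetaMonoid ι' := by
  intro g ι
  exact TemperedThetaMonoids.ThetaEnvData.conj_permutes_both_of_thetaEnvPermuted _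
    (thetaEnvPermuted_thetaEnvRecordOuter C hC hS hl hp2 hpl hζ mods f hf hmods h15 L hZ hcharY hlim _ e₀)
    ((thetaEnvData C hC hS hl hp2 hpl hζ mods f hf hmods h15 L hZ hcharY hlim).toRecord_units_stable _ _ _
      (constantMonoid_stable_thetaEnvRecordOuter C hC hS hl hp2 hpl hζ mods f hf hmods h15 L hZ hcharY hlim
        e₀ c hA hfi O hO)) g ι

include hcharY hO in
/-- **[IUTchII] Prop. 3.1 (ii), both clauses, at `thetaEnvRecordOuterKummer`** (as `prop31ii_thetaEnvRecordKummer`; the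
constant-monoid clauses are independent of the inversion family): under the one input `hinj`.
[claim: Mochizuki2012, status: disputed] (IUTchII §3 Prop 3.1 (ii), kurims p.88) -/
theorem prop31ii_thetaEnvRecordOuterKummer
    (hinj : Function.Injective (h1LimKummer (phi C) (D.lDeltaTheta l) (PiYdd C) c hA hfi)) :
    (thetaEnvRecordOuterKummer C hC hS hl hp2 hpl hζ mods f hf hmods h15 L hZ hcharY hlim e₀ c hA hfi O).IsConjStable
        (thetaEnvRecordOuterKummer C hC hS hl hp2 hpl hζ mods f hf hmods h15 L hZ hcharY hlim e₀ c hA hfi O).constantMonoid ∧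
      (∃ e : O ≃*
          (thetaEnvRecordOuterKummer C hC hS hl hp2 hpl hζ mods f hf hmods h15 L hZ hcharY hlim e₀ c hA hfi O).constantMonoid,
        (∀ x : O, ((e x : (thetaEnvRecordOuterKummer C hC hS hl hp2 hpl hζ mods f hf hmods h15 L hZ hcharY hlim
              e₀ c hA hfi O).constantMonoid) : (thetaEnvRecordOuterKummer C hC hS hl hp2 hpl hζ mods f hf hmods h15 L hZ
              hcharY hlim e₀ c hA hfi O).H) =
            h1LimKummerOn (phi C) (D.lDeltaTheta l) (PiYdd C) c hA hfi O x) ∧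
        (∀ (g : Pi C) (x : O),
          ((e ⟨g • (x : A), hO g x x.2⟩ : (thetaEnvRecordOuterKummer C hC hS hl hp2 hpl hζ mods f hf hmods h15 L hZ hcharY
              hlim e₀ c hA hfi O).constantMonoid) : (thetaEnvRecordOuterKummer C hC hS hl hp2 hpl hζ mods f hf hmods h15 L
              hZ hcharY hlim e₀ c hA hfi O).H) =
            h1LimConjMulAut (phi C) (D.lDeltaTheta l) (PiYdd C) g
              ((e x : (thetaEnvRecordOuterKummer C hC hS hl hp2 hpl hζ mods f hf hmods h15 L hZ hcharY hlim
                e₀ c hA hfi O).constantMonoid) : (thetaEnvRecordOuterKummer C hC hS hl hp2 hpl hζ mods f hf hmods h15 L hZ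
                hcharY hlim e₀ c hA hfi O).H))) ∧
      (∀ x : O, h1LimKummerOn (phi C) (D.lDeltaTheta l) (PiYdd C) c hA hfi O x ∈
          (thetaEnvRecordOuterKummer C hC hS hl hp2 hpl hζ mods f hf hmods h15 L hZ hcharY hlim e₀ c hA hfi O).units ↔
        IsUnit x) := by
  have hinjO := h1LimKummerOn_injective (phi C) (D.lDeltaTheta l) (PiYdd C) c hA hfi O hinj
  refine ⟨constantMonoid_stable_thetaEnvRecordOuter C hC hS hl hp2 hpl hζ mods f hf hmods h15 L hZ hcharY hlim
      e₀ c hA hfi O hO, ?_, fun x => ?_⟩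
  · obtain ⟨e, he⟩ := TemperedThetaMonoids.exists_constantMonoid_mulEquiv
      (thetaEnvRecordOuterKummer C hC hS hl hp2 hpl hζ mods f hf hmods h15 L hZ hcharY hlim e₀ c hA hfi O)
      (h1LimKummerOn (phi C) (D.lDeltaTheta l) (PiYdd C) c hA hfi O) hinjO rfl
    refine ⟨e, he, fun g x => ?_⟩
    rw [he, he]
    exact h1LimKummerOn_smul (phi C) (D.lDeltaTheta l) (PiYdd C) c hA hfi O g x ⟨g • (x : A), hO g x x.2⟩ rfl
  · exact TemperedThetaMonoids.kummer_mem_units_iff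
      (thetaEnvRecordOuterKummer C hC hS hl hp2 hpl hζ mods f hf hmods h15 L hZ hcharY hlim e₀ c hA hfi O)
      (h1LimKummerOn (phi C) (D.lDeltaTheta l) (PiYdd C) c hA hfi O) hinjO rfl x

end Outer

end EtaleLevels

end Literature.IUT.HodgeArakelov

end
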